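import Summits.CriticalPhenomena.SAWScalingLimit.Theorems.SAWRenewalTightnessStripMassConservation
import Mathlib.Topology.Algebra.InfiniteSum.Real
import Mathlib.Topology.Instances.ENNReal.Lemmas
import HarnessLib

/-!
# Line `kesten-product-renewal-dictionary` (crux stmt-CriticalPhenomena-7117): stub R1 — Kesten's
span-renewal equation as an EQUALITY in the word model

Proof file for the registered stub `wordSpanMass_renewal` of the line
`kesten-product-renewal-dictionary` for the crux `SAWTotalPositivity.CriticalBubbleBound`.

Word model of `SAWWords.lean` / `SAWWordBridges.lean` (`Step = Fin 4`, `IsSAW`, `IsBridgeW`,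
`IsIrrBridge`, span `xEnd`), all masses as `ℝ≥0∞`-valued `tsum`s over subtypes of `List Step`:

* `U(L) := Σ_{w self-avoiding bridge word, span w = L} x_c^{|w|}` — Kesten's renewal density `u_L`
  (`x_c = criticalFugacity = 1/μ`);
* `Λ(j) := Σ_{s irreducible bridge, span s = j} x_c^{|s|}` — the inter-arrival law of the renewal.

CONCLUSIONS (this file, theorem `wordSpanMass_renewal`):

1. **The renewal equation** (Madras–Slade (4.2.9)–(4.2.12) at `z = z_c`, as an equality): for `L ≥ 1`,
   `U(L) = Σ_{j=1}^{L} Λ(j) · U(L − j)`. Every non-empty self-avoiding bridge word `w` of span `L` is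
   UNIQUELY `s ++ t` with `s` an irreducible bridge (span `j ∈ [1, L]`) and `t` a self-avoiding bridge
   word of span `L − j`: existence `StripMass.exists_irrBridge_append` (cut at the least break point),
   uniqueness `eq_of_append_eq'` (Kesten's unique decoding), closure under concatenation
   `IsSAW.append_of_bridge`, `IsBridgeW.append`, and additivity of spans `xEnd_append`. The map
   `(j, s, t) ↦ s ++ t` is therefore a bijection onto the words of span `L`
   (`renewal_append_bijective`), and `x_c^{|s ++ t|} = x_c^{|s|} x_c^{|t|}` turns the reindexed `tsum`
   into the finite sum of products (`wordSpanMass_renewal_eq`).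
2. **Normalisation**: from Kesten's identity `Σ_{s irreducible} x_c^{|s|} = 1` (a `HasSum` in `ℝ`,
   hypothesis; Kesten 1963, Madras–Slade (4.2.4)), regrouping the irreducible bridges by their span
   `j ∈ ℕ` gives `Σ_j Λ(j) = 1` in `ℝ≥0∞` (`tsum_irrSpanMass_eq_one_of`): the inter-arrival law is a
   probability law on the spans.

Sources: H. Kesten, *On the number of self-avoiding walks*, J. Math. Phys. 4 (1963) 960–969, §4;
N. Madras, G. Slade, *The Self-Avoiding Walk* (1993), §1.2 (eq. (1.2.15)), §4.2 (Definition 4.2.1,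
eqs. (4.2.1)–(4.2.4), (4.2.9)–(4.2.12)).
-/

noncomputable section

open Literature.Probability.LatticeModels
open Literature.Probability.RandomPlanarGeometry Literature.Probability.RandomPlanarGeometry.SAW
open scoped ENNReal NNReal BigOperators
open Classical

namespace Summit.CriticalPhenomena.SAWScalingLimit.Theorems.CriticalBubbleBound.Kesten.HW

/-! ## The factorisation `w = s ++ t` at the first irreducible bridge is a bijection -/

/-- Closure of Kesten's factorisation under concatenation: if `s` is an irreducible bridge of span
`j ∈ [1, L]` and `t` is a self-avoiding bridge word of span `L - j`, then `s ++ t` is a self-avoiding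
bridge word of span `L` (`IsSAW.append_of_bridge`, `IsBridgeW.append`, `xEnd_append`).
[cite: MadrasSlade1993, §1.2, eq. (1.2.15)] -/
theorem renewal_append_mem {L j : ℕ} (hj : j ∈ Finset.Icc 1 L) {s t : List Step}
    (hs : IsIrrBridge s ∧ xEnd s = (j : ℤ))
    (ht : IsSAW t ∧ IsBridgeW t ∧ xEnd t = ((L - j : ℕ) : ℤ)) :
    IsSAW (s ++ t) ∧ IsBridgeW (s ++ t) ∧ xEnd (s ++ t) = (L : ℤ) := by
  refine ⟨hs.1.saw.append_of_bridge ht.1 hs.1.bridge ht.2.1, hs.1.bridge.append ht.2.1, ?_⟩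
  rw [xEnd_append, hs.2, ht.2.2]
  have hjL := (Finset.mem_Icc.1 hj).2
  omega

/-- **Kesten's factorisation is a bijection.** For `L ≥ 1`, the map `(j, s, t) ↦ s ++ t` from the
triples (`j ∈ [1, L]`, `s` an irreducible bridge of span `j`, `t` a self-avoiding bridge word of span
`L - j`) to the self-avoiding bridge words of span `L` is bijective: injective by unique decoding
(`eq_of_append_eq'`), surjective by cutting a (non-empty) word of span `L ≥ 1` at its least break
point (`StripMass.exists_irrBridge_append`; the head has span `≥ 1`, the tail span `≥ 0`).
[cite: MadrasSlade1993, §4.2, eq. (4.2.1)–(4.2.2)] -/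
theorem renewal_append_bijective {L : ℕ} (hL : 1 ≤ L) :
    Function.Bijective (fun x : (Σ j : ↥(Finset.Icc 1 L),
        {s : List Step // IsIrrBridge s ∧ xEnd s = ((j : ℕ) : ℤ)} ×
          {w : List Step // IsSAW w ∧ IsBridgeW w ∧ xEnd w = ((L - j : ℕ) : ℤ)}) =>
      (⟨x.2.1.1 ++ x.2.2.1, renewal_append_mem x.1.2 x.2.1.2 x.2.2.2⟩ :
        {w : List Step // IsSAW w ∧ IsBridgeW w ∧ xEnd w = (L : ℤ)})) := by
  constructor
  · rintro ⟨⟨j, hj⟩, ⟨s, hs⟩, ⟨t, ht⟩⟩ ⟨⟨j', hj'⟩, ⟨s', hs'⟩, ⟨t', ht'⟩⟩ h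
    have h' : s ++ t = s' ++ t' := congrArg Subtype.val h
    obtain ⟨rfl, rfl⟩ := eq_of_append_eq' hs.1 hs'.1 ht.2.1 ht'.2.1 h'
    have hjj : ((j : ℕ) : ℤ) = (j' : ℤ) := hs.2.symm.trans hs'.2
    obtain rfl : j = j' := by exact_mod_cast hjj
    rfl
  · rintro ⟨w, hsaw, hb, hx⟩
    have hne : w ≠ [] := by
      rintro rfl
      simp only [xEnd, List.length_nil, xAt_zero] at hx
      omega
    obtain ⟨s, t, rfl, hs, ht⟩ := StripMass.exists_irrBridge_append hsaw hb hne
    have hs1 : 1 ≤ xEnd s := StripMass.one_le_xEnd_of_ne_nil hs.bridge hs.ne_nil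
    have ht0 : 0 ≤ xEnd t := ht.xEnd_nonneg
    have hst : xEnd s + xEnd t = (L : ℤ) := by rw [← xEnd_append]; exact hx
    have htsaw : IsSAW t := by
      have h := hsaw.drop s.length
      rwa [List.drop_left] at h
    have hsj : xEnd s = (((xEnd s).toNat : ℕ) : ℤ) := by omega
    have htj : xEnd t = ((L - (xEnd s).toNat : ℕ) : ℤ) := by omega
    exact ⟨⟨⟨(xEnd s).toNat, Finset.mem_Icc.2 ⟨by omega, by omega⟩⟩, ⟨s, hs, hsj⟩,
      ⟨t, htsaw, ht, htj⟩⟩, rfl⟩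

/-! ## The renewal equation `U(L) = Σ_{j=1}^{L} Λ(j) U(L - j)` -/

/-- **Kesten's span-renewal equation at `z_c` as an equality** (Madras–Slade (4.2.9)–(4.2.12)): for
`L ≥ 1`, `U(L) = Σ_{j=1}^{L} Λ(j) · U(L − j)`, where `U(L)` is the critical mass of the self-avoiding
bridge words of span `L` and `Λ(j)` that of the irreducible bridges of span `j`. Reindex the `tsum`
along the bijection `renewal_append_bijective` and split `x_c^{|s ++ t|} = x_c^{|s|} x_c^{|t|}`.
[cite: MadrasSlade1993, §4.2, eq. (4.2.9)–(4.2.12)] -/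
theorem wordSpanMass_renewal_eq {L : ℕ} (hL : 1 ≤ L) :
    (∑' w : {w : List Step // IsSAW w ∧ IsBridgeW w ∧ xEnd w = (L : ℤ)},
        ENNReal.ofReal (criticalFugacity ^ w.1.length)) =
      ∑ j ∈ Finset.Icc 1 L,
        (∑' s : {s : List Step // IsIrrBridge s ∧ xEnd s = (j : ℤ)},
            ENNReal.ofReal (criticalFugacity ^ s.1.length)) *
          (∑' w : {w : List Step // IsSAW w ∧ IsBridgeW w ∧ xEnd w = ((L - j : ℕ) : ℤ)},
            ENNReal.ofReal (criticalFugacity ^ w.1.length)) := by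
  have hxc : 0 ≤ criticalFugacity := StripMass.criticalFugacity_pos.le
  rw [← (Equiv.ofBijective _ (renewal_append_bijective hL)).tsum_eq, ENNReal.tsum_sigma',
    ← Finset.tsum_subtype]
  refine tsum_congr fun j => ?_
  rw [ENNReal.tsum_prod', ← ENNReal.tsum_mul_right]
  refine tsum_congr fun s => ?_
  rw [← ENNReal.tsum_mul_left]
  refine tsum_congr fun t => ?_
  rw [Equiv.ofBijective_apply, List.length_append, pow_add, ENNReal.ofReal_mul (pow_nonneg hxc _)]

/-! ## Normalisation: `Σ_j Λ(j) = 1` from Kesten's identity -/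

/-- Regrouping the irreducible bridges by their span: the map `(j, s) ↦ s` from the pairs
(`j ∈ ℕ`, `s` an irreducible bridge of span `j`) to the irreducible bridges is a bijection (the span
of a bridge is `≥ 0`, so it is a natural number). [cite: MadrasSlade1993, Definition 1.2.4] -/
theorem irrBridge_span_bijective :
    Function.Bijective (fun x : (Σ j : ℕ, {s : List Step // IsIrrBridge s ∧ xEnd s = (j : ℤ)}) =>
      (⟨x.2.1, x.2.2.1⟩ : {w : List Step // IsIrrBridge w})) := by
  constructor
  · rintro ⟨j, s, hs⟩ ⟨j', s', hs'⟩ h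
    have h' : s = s' := congrArg Subtype.val h
    subst h'
    have hjj : ((j : ℕ) : ℤ) = (j' : ℤ) := hs.2.symm.trans hs'.2
    obtain rfl : j = j' := by exact_mod_cast hjj
    rfl
  · rintro ⟨w, hw⟩
    have h0 : 0 ≤ xEnd w := hw.bridge.xEnd_nonneg
    exact ⟨⟨(xEnd w).toNat, w, hw, by omega⟩, rfl⟩

/-- **`Σ_j Λ(j) = 1`**: if the critical masses of the irreducible bridges sum to one (Kesten's identity,
`HasSum` in `ℝ`), then, regrouped by span, `Σ'_{j ∈ ℕ} Σ'_{s irreducible, span s = j} x_c^{|s|} = 1` in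
`ℝ≥0∞` — the inter-arrival law of Kesten's renewal process is a probability law on the spans.
[cite: Kesten1963SAW, §4] -/
theorem tsum_irrSpanMass_eq_one_of
    (hK : HasSum (fun w : {w : List Step // IsIrrBridge w} => criticalFugacity ^ w.1.length) 1) :
    (∑' j : ℕ, ∑' s : {s : List Step // IsIrrBridge s ∧ xEnd s = (j : ℤ)},
      ENNReal.ofReal (criticalFugacity ^ s.1.length)) = 1 := by
  have hxc : 0 ≤ criticalFugacity := StripMass.criticalFugacity_pos.le
  have h1 : (∑' w : {w : List Step // IsIrrBridge w}, ENNReal.ofReal (criticalFugacity ^ w.1.length)) = 1 := by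
    rw [← ENNReal.ofReal_tsum_of_nonneg (fun w => pow_nonneg hxc _) hK.summable, hK.tsum_eq,
      ENNReal.ofReal_one]
  rw [← h1, ← (Equiv.ofBijective _ irrBridge_span_bijective).tsum_eq, ENNReal.tsum_sigma']
  rfl

/-! ## The registered stub -/

/-- **Stub R1 of the line `kesten-product-renewal-dictionary`** (registered signature, verbatim):
(1) Kesten's span-renewal equation at the critical fugacity as an EQUALITY in the word model — for
`L ≥ 1` the critical mass `U(L)` of the self-avoiding bridge words of span `L` equals
`Σ_{j=1}^{L} Λ(j) U(L − j)`, `Λ(j)` the critical mass of the irreducible bridges of span `j` (unique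
factorisation at the first irreducible bridge); (2) given Kesten's identity `Σ_{s irreducible} x_c^{|s|} = 1`,
the spans of the irreducible bridges carry a probability law, `Σ_j Λ(j) = 1`.
[cite: MadrasSlade1993, §4.2, eq. (4.2.9)–(4.2.12)] -/
theorem wordSpanMass_renewal : (∀ L : ℕ, 1 ≤ L → (∑' w : {w : List Step // IsSAW w ∧ IsBridgeW w ∧ xEnd w = (L : ℤ)}, ENNReal.ofReal (criticalFugacity ^ w.1.length)) = ∑ j ∈ Finset.Icc 1 L, (∑' s : {s : List Step // IsIrrBridge s ∧ xEnd s = (j : ℤ)}, ENNReal.ofReal (criticalFugacity ^ s.1.length)) * (∑' w : {w : List Step // IsSAW w ∧ IsBridgeW w ∧ xEnd w = ((L - j : ℕ) : ℤ)}, ENNReal.ofReal (criticalFugacity ^ w.1.length))) ∧ (HasSum (fun w : {w : List Literature.Probability.RandomPlanarGeometry.SAW.Step // Literature.Probability.RandomPlanarGeometry.SAW.IsIrrBridge w} => Literature.Probability.RandomPlanarGeometry.SAW.criticalFugacity ^ w.1.length) 1 → (∑' j : ℕ, ∑' s : {s : List Step // IsIrrBridge s ∧ xEnd s = (j : ℤ)},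 ENNReal.ofReal (criticalFugacity ^ s.1.length)) = 1) :=
  ⟨fun _ hL => wordSpanMass_renewal_eq hL, fun hK => tsum_irrSpanMass_eq_one_of hK⟩

end Summit.CriticalPhenomena.SAWScalingLimit.Theorems.CriticalBubbleBound.Kesten.HW

end
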